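import Summits.QuantumFields.YangMills.Theorems.BalabanUVNodesN15KingModelFullPropagatorBackwardLetters
import Summits.QuantumFields.YangMills.Theorems.BalabanUVNodesN15CovariantLandauFlatTwoGridRowsKing
import HarnessLib

/-!
# Route «BalabanUVNodes», node N15 = NE2, road (c) — THE FLAT TWO-GRID ROW OF THE **BACKWARD** GRADIENT `S_{−κ}∂_μG′(1)` OF THE LANDAU LETTER's PRIMITIVE FAMILY,
# MASSLESS, IN THE LANE's GEOMETRY — from dag-n15-e's `hasMaj_idef_kingDOpBack` (King's (3.73) two-spacing rate of the forward piece, shifted back one step, + the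
# one-step Hölder modulus paying the floor pairing's shift defect) at `m² → 0⁺` (dag-n15-a g34, (Ξ-2): the scalar core of n15-c∕237's flat input `ε_D⁻`)

Cell `pub-ymgap`, seat `pub-ymgap-dag-n15-a` (generation g34; KNIT-BY-NAME lane; HUMAN RULING D-0062; chair R424 venue).  `bears_on: R4∕N15 · K3⁸ SpineGivenEndpointR13SepCoPHV
(stmt-QuantumFields-27366)`; filed `--supports stmt-QuantumFields-27366 --as helper` — COUNT-NEUTRAL.  Theorems only; 0 `sorry`; HYPOTHESIS-FREE on King's torus family `M_μ = 2L^e`,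
coarse run `L^K` (`K ≥ 1`), fine run `L^nL^K` (`n ≥ 1`), `L` odd `≥ 3`, `a₀ > 0`, rate exponent `0 < γ < 1∕2`.  Imports BY NAME: dag-n15-e `…KingModelFullPropagatorBackwardLetters`
(★★ `hasMaj_idef_kingDOpBack`: the two-grid defect of `S_{−κ}∘D_μ`, `D_μ = N∇_μA₀⁻¹`, through King's pairing `underPtN`, in the SIZED geometry `unitTorusGeoS`, masses `0 < m² ≤ m₀²`;
`kingDOp`, `kingDOp_apply`, `blockOf_comp_underPtN`), (Ξ-1) `…CovariantLandauFlatTwoGridRowsKing` (`gradFlat_mulVec_apply`; through it n15-c∕220's dictionary `greenFlat_eq_fineOp_inv`, dag-n15-a `abs_le_of_Ioc`, n15-c g7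
`continuousAt_fineOp_inv_mulVec_mass`, the lane's geometry `B6UnitTorusCarrier.unitTorusGeo`, `B11AxialTransport190.loc_ofBlocks_le ∕ abs_le_loc_ofBlocks`).  Nothing in the tree is modified.

WHY.  dag-n15-c g24's (G3) road (the two-grid η-defect of the Landau letter `N_V^R`) displays, after n15-c∕236 (`G′(T)`: flat inputs `ε_G`, `ε_A` = (Ξ-1) `flatTwoGridRow_green∕adjGrad_king`),
in n15-c∕237 the gradient defect `X_D` «via the scalar fixed point `Z = (Bᵀ − ℭ_N)∂G′(T)` (kernels `∂G′(1)` and the BACKWARD gradient `Sh∂G′(1)`; flat inputs `ε_D`, `ε_D⁻`)».  `ε_D` is (Ξ-1)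
`flatTwoGridRow_grad_king`.  THIS FILE is the SCALAR CORE of `ε_D⁻`: for every shift direction `κ` and bond direction `μ`, the two-grid η-defect of `x ↦ (N∇_μG′(1)λ)(x − e_κ)` through
King's pairing, MASSLESS, between the sharp unit-block sizes of the lane's geometry `unitTorusGeo L K M` — dag-n15-e's `hasMaj_idef_kingDOpBack` read at `Msz := 1` (the block sizes do not
see the size field: §1 `HasMaj.of_geoS`), at `α := γ`, rate `2γ`, and at `m² → 0⁺` (§1 `hasMaj_ofBlocks_of_Ioc`: a block majorant shared by a family of operators continuous in the mass at
`0` passes to the massless operator).  The bond ∕ colour packaging of n15-c∕237's display (`tensorId`, direction bundling) is the sequel (Ξ-3), once 237's letter for `Sh` is in the tree.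
* §1 `HasMaj.of_geoS` (sized ↦ plain geometry, same blocks), `hasMaj_ofBlocks_of_Ioc` (massive family ↦ massless member);
* §2 ★★★ `flatTwoGridRow_gradBack_king_scalar` — `∃ C δ > 0 ∀ K ≥ 1 ∀ n ≥ 1 ∀ e (M = 2L^e) ∀ κ μ`:
  `HasMaj (ofBlocks (unitTorusGeo L K M) (blockOf (L^K) M)) (ofBlocks … (blockOf (L^nL^K) M)) (idef (pull pr) (pull pr) (S″_{−κ}∘D″_μ) (S′_{−κ}∘D′_μ)) (C·(L^K)^{−γ}·e^{−δ|y−y′|_T})`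
  with `D = kingDOp L a₀ 0 …` (MASSLESS: `N·((fineOp N M a_K N² 0)⁻¹λ)(x + e_μ) − …`), coarse coupling `a_K`, fine coupling `a_{K+n}`;
  `kingDOp_zero_apply_eq_gradFlat` — the dictionary to the lane's flat letters: `D_μ(m² = 0)λ (x) = (∂(G′(1)λ))(x, μ)` at the mass `a_K·N^{d+1}` (n15-c∕220 `greenFlat_eq_fineOp_inv`).

HONEST FRAMING ∕ LIMITS.  King's `A = 0` MODEL statements ([King1986] template literature: Prop. 3.9 (3.73) + Thm 3.3 (3.7)–(3.8), typed and proved in the tree by dag-n15-e) read at `m² = 0`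
on Bałaban's flat objects at `U ≡ 1`; periodic b.c., `K, n ≥ 1`, tori `2L^e`, odd `L ≥ 3`, rate exponent `0 < γ < 1∕2` (currency: `min` of King's `γ∕2` and the Hölder order `α`), King's
PAIRED couplings; NOT [Balaban1985BackgroundPropagators] Thm 3.1 as printed; NE2⁺ NOT PRINTED; N15 of record untouched (DISCHARGED AS CONSUMED, p687738); counts UNMOVED (typed 28∕28 ·
discharged 8∕27); one finite 𝕋⁴ at fixed ε per index — NOT infinite volume ∕ OS ∕ mass gap ∕ Clay.  Restate-immune (no Theses import).  No `sorry`, `instance`, `notation`; standard axioms.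
-/

noncomputable section

open scoped BigOperators Matrix Kronecker

namespace Summit.QuantumFields.YangMills.BalabanUVNodes.N15.CovLandau

open Literature.MathematicalPhysics.QuantumFieldTheory.Balaban1983to89
open Literature.MathematicalPhysics.QuantumFieldTheory.Balaban1983to89.B5Prop11Plancherel (Tor fine unitVec)
open Literature.MathematicalPhysics.QuantumFieldTheory.Balaban1983to89.B11SectG (BlockNorm HasMaj)
open Literature.MathematicalPhysics.QuantumFieldTheory.Balaban1983to89.B11AxialTransport190 (abs_le_loc_ofBlocks loc_ofBlocks_le)
open Literature.MathematicalPhysics.QuantumFieldTheory.Balaban1983to89.B6UnitTorusCarrier (unitTorusGeo)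
open Literature.MathematicalPhysics.QuantumFieldTheory.Balaban1983to89.T4EtaRateDefect (idef idef_apply)
open Literature.MathematicalPhysics.QuantumFieldTheory.Balaban1983to89.T4EtaRateCoeffDefect (pull pull_apply)
open Literature.MathematicalPhysics.QuantumFieldTheory.King1986 (aK aK_pos aK_le)
open Literature.MathematicalPhysics.QuantumFieldTheory.King1986.Torus (blockOf tdistT tdistT_nonneg fineOp)
open Summit.QuantumFields.YangMills.BalabanUVNodes.N15.VectorPiece (unitTorusGeoS kingPr)
open Summit.QuantumFields.YangMills.BalabanUVNodes.N15.TwoGrid (abs_le_of_Ioc)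
open Summit.QuantumFields.YangMills.BalabanUVNodes.N15.SiteLayerBg (continuousAt_fineOp_inv_mulVec_mass)
open Summit.QuantumFields.YangMills.BalabanUVNodes.N15KingModelRung.Curved (underPtN blockOf_underPtN blockOf_comp_underPtN kingDOp kingDOp_apply hasMaj_idef_kingDOpBack)

variable {d : ℕ}

/-! ## §1 Two transfers: the size field is invisible to the sharp block sizes; a massive family's majorant passes to the massless member -/

section Transfer

variable (L : ℕ)

/-- **The sharp unit-block sizes do not read the size field**: a block majorant over the SIZED carrier `unitTorusGeoS L k M Msz` (dag-n15-e's currency) IS one over the lane's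
`unitTorusGeo L k M` (same sites, same blocks, same distance). [folklore] -/
theorem HasMaj.of_geoS {M : Fin (d + 1) → ℕ} [∀ μ, NeZero (M μ)] {k : ℕ} {Msz : ℝ} {X₁ X₂ : Type} [Fintype X₁] [Fintype X₂] {blk₁ : X₁ → Tor M} {blk₂ : X₂ → Tor M}
    {T : (X₁ → ℝ) →ₗ[ℝ] (X₂ → ℝ)} {Kf : Tor M → Tor M → ℝ}
    (h : HasMaj (BlockNorm.ofBlocks (unitTorusGeoS L k M Msz) blk₁) (BlockNorm.ofBlocks (unitTorusGeoS L k M Msz) blk₂) T Kf) :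
    HasMaj (BlockNorm.ofBlocks (unitTorusGeo L k M) blk₁) (BlockNorm.ofBlocks (unitTorusGeo L k M) blk₂) T Kf :=
  fun y' lam hlam y => h y' lam hlam y

/-- **A block majorant shared by a family `T m`, `m ∈ (0, m₀]`, of operators continuous in `m` at `0` (pointwise on sources and points) is a block majorant of `T 0`** — the massless member
inherits the massive family's bound (the sharp block size of the output is a finite sup of absolute values). [folklore] -/
theorem hasMaj_ofBlocks_of_Ioc {M : Fin (d + 1) → ℕ} [∀ μ, NeZero (M μ)] (k : ℕ) {X₁ X₂ : Type} [Fintype X₁] [Fintype X₂] (blk₁ : X₁ → Tor M) (blk₂ : X₂ → Tor M)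
    (T : ℝ → ((X₁ → ℝ) →ₗ[ℝ] (X₂ → ℝ))) {Kf : Tor M → Tor M → ℝ} (hK : ∀ y y', 0 ≤ Kf y y') {m0 : ℝ} (hm0 : 0 < m0)
    (hc : ∀ (lam : X₁ → ℝ) (x : X₂), ContinuousAt (fun m => T m lam x) 0)
    (h : ∀ m : ℝ, 0 < m → m ≤ m0 → HasMaj (BlockNorm.ofBlocks (unitTorusGeo L k M) blk₁) (BlockNorm.ofBlocks (unitTorusGeo L k M) blk₂) (T m) Kf) :
    HasMaj (BlockNorm.ofBlocks (unitTorusGeo L k M) blk₁) (BlockNorm.ofBlocks (unitTorusGeo L k M) blk₂) (T 0) Kf := by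
  intro y' lam hlam y
  have hL0 := (BlockNorm.ofBlocks (unitTorusGeo L k M) blk₁).loc_nonneg y' lam
  refine loc_ofBlocks_le (g := unitTorusGeo L k M) blk₂ _ (mul_nonneg (hK y y') hL0) fun x hx => ?_
  exact abs_le_of_Ioc hm0 (hc lam x) fun m hm hm' => (abs_le_loc_ofBlocks (g := unitTorusGeo L k M) blk₂ (T m lam) hx).trans (h m hm hm' y' lam hlam y)

end Transfer

/-! ## §2 The scalar core of `ε_D⁻`: the two-grid η-defect of the backward piece, massless, hypothesis-free -/

section Back

variable (L : ℕ) [NeZero L]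

omit [NeZero L] in
/-- DICTIONARY: the rung's MASSLESS forward piece IS the lane's flat gradient of the flat propagator — `(D_μλ)(x) = N·((G′(1)λ)(x + e_μ) − (G′(1)λ)(x))` with `G′(1) = (fineOp N M a_K N² 0)⁻¹`
`= greenFlat M N (a_K·N^{d+1})` (n15-c∕220 `greenFlat_eq_fineOp_inv`). [cite: King1986, (4.5) p.670; Balaban1985BackgroundPropagators, (3.24)–(3.25) pp.394–395 (at `U ≡ 1`)] -/
theorem kingDOp_zero_apply_eq_gradFlat (a₀ : ℝ) (K N : ℕ) [NeZero N] (M : Fin (d + 1) → ℕ) [∀ μ, NeZero (M μ)] (μ : Fin (d + 1)) (lam : Tor (fine N M) → ℝ) (x : Tor (fine N M)) :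
    kingDOp L a₀ 0 K N M μ lam x = (gradFlat M N *ᵥ (greenFlat M N (aK a₀ (L : ℝ) K * (N : ℝ) ^ (d + 1)) *ᵥ lam)) (x, μ) := by
  rw [kingDOp_apply, greenFlat_eq_fineOp_inv, gradFlat_mulVec_apply]

/-- ★★★ **THE SCALAR CORE OF `ε_D⁻` — THE FLAT TWO-GRID ROW OF THE BACKWARD PIECE `S_{−κ}∘∂_μG′(1)`, MASSLESS, HYPOTHESIS-FREE ON KING's TORUS FAMILY.**  For odd `L ≥ 3`, `a₀ > 0` and
`0 < γ < 1∕2` there are `C, δ > 0` such that for every `K ≥ 1`, `n ≥ 1`, every torus `M_μ = 2L^e` and all directions `κ, μ`, with King's pairing `pr = kingPr L K n M` and the MASSLESS pieces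
`D′_μ = kingDOp L a₀ 0 K (L^K) M μ`, `D″_μ = kingDOp L a₀ 0 (K + n) (L^nL^K) M μ` (couplings `a_K`, `a_{K+n}`):
`HasMaj (ofBlocks (unitTorusGeo L K M) (blockOf (L^K) M)) (ofBlocks … (blockOf (L^nL^K) M)) (𝔇(S″_{−κ}∘D″_μ, S′_{−κ}∘D′_μ)) (C·(L^K)^{−γ}·e^{−δ|y−y′|_T})` — dag-n15-e's `hasMaj_idef_kingDOpBack`
(rate `(L^K)^{−2γ∕2} + (L^K)^{−γ}`, `α := γ`) at `Msz := 1`, read in the lane's geometry and passed to `m² = 0`.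
[cite: King1986, Prop. 3.9 (3.73) p.665, Thm 3.3 (3.7)–(3.8) pp.655–656, p.664 («x′ ∈ B^n(x)»); Balaban1983RegularityDecay, (1.9)–(1.10) p.573; Balaban1985BackgroundPropagators, Thm 3.1 (3.42)–(3.43) pp.397–398, (3.64) p.403 (`D⁻_U`: shape)] -/
theorem flatTwoGridRow_gradBack_king_scalar (hLodd : Odd L) (hL : 2 ≤ L) {a₀ : ℝ} (ha₀ : 0 < a₀) {γ : ℝ} (hγ0 : 0 < γ) (hγ1 : γ < 1 / 2) :
    ∃ C δ : ℝ, 0 < C ∧ 0 < δ ∧ ∀ (K : ℕ), 1 ≤ K → ∀ (n : ℕ), 1 ≤ n → ∀ (e : ℕ) (M : Fin (d + 1) → ℕ) [∀ μ, NeZero (M μ)], (∀ μ, M μ = 2 * L ^ e) →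
      ∀ (κ μ : Fin (d + 1)),
        HasMaj (BlockNorm.ofBlocks (unitTorusGeo L K M) (blockOf (L ^ K) M)) (BlockNorm.ofBlocks (unitTorusGeo L K M) (blockOf (L ^ n * L ^ K) M))
          (idef (pull (kingPr L K n M)) (pull (kingPr L K n M))
            (pull ⇑(Equiv.addRight (unitVec (fine (L ^ n * L ^ K) M) κ)).symm ∘ₗ kingDOp L a₀ 0 (K + n) (L ^ n * L ^ K) M μ)
            (pull ⇑(Equiv.addRight (unitVec (fine (L ^ K) M) κ)).symm ∘ₗ kingDOp L a₀ 0 K (L ^ K) M μ))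
          (fun y y' => C * ((L : ℝ) ^ K) ^ (-γ) * Real.exp (-(δ * tdistT M y y'))) := by
  obtain ⟨C, δ, hC, hδ, H⟩ := hasMaj_idef_kingDOpBack (d := d) L hLodd hL ha₀ zero_le_one (γ := 2 * γ) (by linarith) (by linarith) (α := γ) hγ0 (by linarith)
  refine ⟨2 * C, δ, by positivity, hδ, ?_⟩
  intro K hK n hn e M _ hM κ μ
  have hL1r : (1 : ℝ) < L := by exact_mod_cast (lt_of_lt_of_le one_lt_two hL)
  have hL0 : (0 : ℝ) ≤ (L : ℝ) := Nat.cast_nonneg L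
  have haK : 0 < aK a₀ (L : ℝ) K := aK_pos ha₀ hL1r hK
  have haK' : 0 < aK a₀ (L : ℝ) (K + n) := aK_pos ha₀ hL1r (le_add_right hK)
  have hθ : 0 ≤ ((L : ℝ) ^ K) ^ (-γ) := Real.rpow_nonneg (pow_nonneg hL0 K) _
  have hrate : ((L : ℝ) ^ K) ^ (-(2 * γ / 2)) = ((L : ℝ) ^ K) ^ (-γ) := by rw [show -(2 * γ / 2) = -γ by ring]
  -- the massive family, read in the lane's geometry with the fine run's own unit blocks
  have key : ∀ m : ℝ, 0 < m → m ≤ 1 →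
      HasMaj (BlockNorm.ofBlocks (unitTorusGeo L K M) (blockOf (L ^ K) M)) (BlockNorm.ofBlocks (unitTorusGeo L K M) (blockOf (L ^ n * L ^ K) M))
        (idef (pull (kingPr L K n M)) (pull (kingPr L K n M))
          (pull ⇑(Equiv.addRight (unitVec (fine (L ^ n * L ^ K) M) κ)).symm ∘ₗ kingDOp L a₀ m (K + n) (L ^ n * L ^ K) M μ)
          (pull ⇑(Equiv.addRight (unitVec (fine (L ^ K) M) κ)).symm ∘ₗ kingDOp L a₀ m K (L ^ K) M μ))
        (fun y y' => 2 * C * ((L : ℝ) ^ K) ^ (-γ) * Real.exp (-(δ * tdistT M y y'))) := fun m hm hm' => by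
    have h := H K hK n hn e M hM m hm hm' (1 : ℝ) κ μ
    rw [blockOf_comp_underPtN, hrate] at h
    refine (HasMaj.of_geoS L h).mono fun y y' => le_of_eq ?_
    show C * (((L : ℝ) ^ K) ^ (-γ) + ((L : ℝ) ^ K) ^ (-γ)) * Real.exp (-(δ * tdistT M y y')) = 2 * C * ((L : ℝ) ^ K) ^ (-γ) * Real.exp (-(δ * tdistT M y y'))
    ring
  -- the massless member by continuity in the mass at `0`
  refine hasMaj_ofBlocks_of_Ioc L K (blockOf (L ^ K) M) (blockOf (L ^ n * L ^ K) M)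
    (fun m => idef (pull (kingPr L K n M)) (pull (kingPr L K n M))
      (pull ⇑(Equiv.addRight (unitVec (fine (L ^ n * L ^ K) M) κ)).symm ∘ₗ kingDOp L a₀ m (K + n) (L ^ n * L ^ K) M μ)
      (pull ⇑(Equiv.addRight (unitVec (fine (L ^ K) M) κ)).symm ∘ₗ kingDOp L a₀ m K (L ^ K) M μ))
    (fun y y' => by positivity) one_pos (fun lam x' => ?_) key
  simp only [idef_apply, Pi.sub_apply, LinearMap.coe_comp, Function.comp_apply, pull_apply, kingDOp_apply]
  exact (continuousAt_const.mul ((continuousAt_fineOp_inv_mulVec_mass M (L ^ n * L ^ K) haK' _ _).sub (continuousAt_fineOp_inv_mulVec_mass M (L ^ n * L ^ K) haK' _ _))).sub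
    (continuousAt_const.mul ((continuousAt_fineOp_inv_mulVec_mass M (L ^ K) haK _ _).sub (continuousAt_fineOp_inv_mulVec_mass M (L ^ K) haK _ _)))

end Back

end Summit.QuantumFields.YangMills.BalabanUVNodes.N15.CovLandau

end
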